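import Literature.MathematicalPhysics.QuantumFieldTheory.Balaban1983to89.T4TwoRunMatching

/-!
# NE4TwoRunChannels — binder row NE4 (spine node U2), technique P2 «two-trajectory comparison at spacings ε vs ε/L»,
# ROUND-2 SKELETON: the located two-run renewal estimate `T4TwoRunMatching.TwoRunRenewal` (cell GAPS G-ne4p2-1) CUT INTO
# ONE-STEP CHANNELS — the Duhamel channels of ONE pair-birth (explicit η-sources, coupling Lipschitz, memory through the
# curly bracket of [Balaban1987RG1] (2.12) with a coefficient μ that carries the coupling, B's unpartnered finest bracket),
# the birth-level projection onto the propagating (marginal-free) bracket, and the LINEAR TRANSPORT LAW of older pair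
# discrepancies («in the old only a background field is changed», (0.22)) with a (2.43)-type age contraction ω and a fresh
# transport source — and the kernel bookkeeping «channels ⇒ TwoRunRenewal ∧ FadingMemory (μp₀/ω) ω», «channels + read-out +
# (AF-0r) + runs + window ⇒ node U2's spine output `T4CauchySum.InjectedRate` BY TYPE» (cell `pub-balaban`, T⁴-continuum
# fan-out, `HOME/BINDER-OWNERS.md` row NE4, co-owner seat t4-ne4-p2, skeleton `HOME/t4/skeletons/NE4-t4-ne4-p2.md`).

HONEST FRAMING (T4-DAG PAGE 1).  The cell's T⁴ target is rung (B)+1: existence AND uniqueness of the ε → 0 limit of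
gauge-invariant observables on a FIXED finite torus T⁴ — NOT infinite volume, NOT a mass gap, NOT the Clay problem.  The
spine estimate NE4 («η-rate of the full β_k»; β⁰-half = the β sub-cell's (AF-0r), β¹-half + fading memory = node U2's own
content) is NOT PRINTED in [Balaban1987RG1]–[Balaban1989LargeFieldII] and is NOT PROVED here.  This module ASSERTS NOTHING
about Bałaban's effective actions: every `def … : Prop` below is a HYPOTHESIS SHAPE over real sequences (the typing of a
one-step statement that is NOT in print), consumed only as a binder; every theorem is elementary real arithmetic (finite
sums, two geometric-series identities, one induction on the age).  CONDITIONALS BY NAME, never hidden: (AF-0r) is the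
binder `hconv` (field `conv` of the β sub-cell's `Beta.Assembly.LimitForm`, member of `FlowStep.BetaPertH`, NOT discharged
for Bałaban's β); the infrared-pinned runs inside the box (node U1/H3; (B)/(B^μ) live there) are the binders
`hrun`/`hbox`/`hpin`; the read-out estimate `T4TwoRunMatching.TwoRunReadOut` (GAPS G-ne4p2-2) stays a binder `hread`.
HONEST DEPENDENCY (cell, verbatim): continuum YM on T⁴ ⇐ BetaPertH ∧ nine spine estimates (0/9 proved); BetaPertH ⇐ (D1) ∧
(D4) ∧ CAP+tail; G-an2-4 gates asym, D1 and NE2/3/4.  VALUE = kernel bookkeeping of the skeleton's leaf cut; NOT an estimate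
on Bałaban's (2.13), NOT summit progress.

WHAT PRINT SAYS (loci quoted VERBATIM in the header of the imported `T4TwoRunMatching` and in `B12Beta`, read there on the
×2 renders of [Balaban1987RG1] pp. 256, 264, 267–268 by the lineage; this seat re-read p. 264 [PDF 16] and pp. 267–268
[PDF 19–20] as images for the skeleton; nothing is re-interpreted): (0.20)/(2.15) the coupling recursion; (0.22)–(0.23)
the growing flag of brackets, «in the old only a background field is changed»; (2.12)–(2.13) the new term
E^{(k+1)}(g_k, U_{k+1}) = log ∫dμ_{C^{(k)}}(B) χ_k exp[P^{(k)}(g_k, U_{k+1}, B) + {E_k(U_k(exp i[g_kCB − hD̃(g_kCB)]V^{(k)})) −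
E_k(U_k(V^{(k)}))}], «the measure becomes a Gaussian measure in variables B, with the covariance C^{(k)} = C^{(k)}(U_{k+1}) =
(C*Δ^{(k)}C)⁻¹» (p. 268), «the expression under the exponential above vanishes at g_k = 0» (p. 268); p. 264: «Let us denote
E^{(j+1)}(g_j, B) = E^{(j+1)}(g_j, U_{j+1}(exp iB))», (1.20) Π = δ²E^{(j+1)}/δB δB at B = 0, (1.22) β_{j+1}(g_j) =
Σ_x Π_{j+1,μν}(g_j, x)x_μx_ν — the read-out is a fixed second-moment functional of the new term COMPOSED WITH THE RUN'S
MINIMIZER, as a function of the coarse-lattice field B.  [Balaban1988Convergent] Thm 2 (2.43) p. 263: the printed SIZE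
contraction (L^{−β})^{n−j} of old-scale terms — the TYPE of the transport contraction ω below.  NOT PRINTED anywhere in
[I]–[III] (cell cross-reads `t4/T4-XREAD-U2.md` §3, `t4/T4-XREAD-U2R2.md`; GAPS G-t4-U2-1, G-t4-U2-2, G-t4-U2R-1…-4, G-ne4p2-1, G-ne4p2-2):
any comparison of objects built at two lattice spacings, any modulus of continuity of one renormalization step in the
previous action or in g_k, any contraction of DIFFERENCES under transport.

THE MODELLING POINT (real sequences; the function-space meaning is documentation, exactly as in `T4TwoRunMatching`).
Run A = K steps of (0.20) from ε = L^{−K}, run B = K + 1 steps from ε/L, pair j = A-step j + 1 ↔ B-step j + 2 (same coarse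
lattices, one more fine level below in B).  Per pair j < K:
* `b j` ≥ the BIRTH DISCREPANCY: the norm, on the common space of functions of the coarse-lattice field (p. 264's
  E(g, U(exp iB))), of the difference of the two runs' new (2.13)-terms — the quantity the read-out (1.22) sees
  (`TwoRunReadOut S r gA gB b K`: β¹-mismatch ≤ r·b_j);
* `e i n` ≥ the norm of the pair-i discrepancy of the PROPAGATING (marginal-free, (0.23)) brackets at AGE n, i.e. after
  transport to A-level i + 1 + n; `e i 0 ≤ p₀·b_i + z_i` (`hproj`: projection constant p₀ = 1 + ‖A^η∘U‖·r, plus the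
  discrepancy z_i of the explicit part of the merged bracket — the normalized one-loop log-determinant, an NE2-kind source);
* TRANSPORT LAW `e i (n+1) ≤ ω·e i n + τ i n` (`TransportLaw`): re-expression on the next background is LINEAR, contracts
  by the (2.43)-type factor ω, and picks up a fresh η-source τ (old term's field derivative × the one-level minimizer map's
  η-rate: `τ i n ≤ aτ·ρ^i·ν^n`, ν < ω);
* BIRTH CHANNELS `b j ≤ σ_j + ℓ′·|g^A_j − g^B_{j+1}| + μ·(Σ_{i<j} e i (j−1−i) + u_j)` (`BirthChannels`): σ_j ≤ a₁ρ^j the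
  explicit η-sources of the Duhamel formula (covariance C^{(k)}, exponent P^{(k)}, minimizer maps, small-field indicator —
  rows NE2/NE3's objects), ℓ′ the coupling Lipschitz constant (Cauchy in g_k), μ the MEMORY COEFFICIENT of the curly bracket
  acting on the old-action discrepancy Σ_{i<j} e i (j−1−i) and on B's unpartnered finest bracket u_j ≤ aU·ρ^j (full size ×
  age contraction).  The skeleton's located leaf L-μ (NOT PRINTED): μ is of order g_k (first moment of the shift g_kCB under
  the step's expansion, plus an exponentially small small-field boundary term) over the field-analyticity radius, BECAUSE
  the exponent of (2.13), in particular the curly bracket, vanishes at g_k = 0 (p. 268) and D̃ begins with quadratic terms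
  (p. 267).
CONSEQUENCE (§2): `TwoRunRenewal a ℓ′ ρ M gA gB b K` with `M j i = μ·p₀·ω^{j−1−i}`, `FadingMemory (μp₀/ω) ω M`, and
`a = a₁ + μ·aU + μ·(aZ + aτ/(ω − ν))/(ρ − ω)`; the memory GAP of `T4TwoRunMatching.disc_le_of_twoRun` reads
`(1 + μp₀/ω)·ω = ω + μ·p₀ < ρ` (`gap_iff`) — IF leaf L-μ holds with μ(γ) → 0 as γ → 0, the gap is met by taking γ small
AFTER L, Bałaban's own order of constants ([Balaban1987RG1] Thm 3 p. 264 «The constant γ depends on all other constants»),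
which would defuse hazard (H1)/G-t4-U2R-2 of the box-uniform typing (there a constant C = C(L) faced ω = L^{−α} with no
coupling in between); whether L-μ holds for Bałaban's (2.13) is OPEN (skeleton §6).  §3: node U2's spine output BY TYPE.

NEW module of unit `b2b-balaban-t4-ne4-p2` (gen 18, ROUND-2 skeleton-first; binder row NE4 co-owner, technique P2); imports
`T4TwoRunMatching` only (hence `T4BetaMemory`, `T4CouplingMatching`, `FlowStep`, `B12Beta`, `T4CauchySum`) and modifies
nothing; Mathlib otherwise; no `sorry`, no `axiom`.
-/

namespace Summit.QuantumFields.BalabanUV.T4Continuum.NE4TwoRunChannels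

open Literature.MathematicalPhysics.QuantumFieldTheory.Balaban1983to89
open FlowStep (HBeta RGEqH)
open T4CouplingMatching (disc FadingMemory)
open T4TwoRunMatching (TwoRunRenewal TwoRunReadOut)
open Finset

/-! ## §1 Hypothesis shapes — the one-step channels (binders only; nothing asserted) -/

/-- HYPOTHESIS SHAPE `TransportLaw` (NOT PRINTED as a statement on differences; asserted nowhere): the pair-`i` discrepancy of the
propagating brackets at age `n + 1` is at most `ω ×` its value at age `n` plus a fresh transport source `τ i n` — the
re-expression of an old term on the next background ((0.22) «in the old only a background field is changed») is LINEAR in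
the term, contracts irrelevant terms by the (2.43)-type factor `ω`, and the two runs' one-level minimizer maps differ at a
geometric η-rate (row NE3).  Levels are capped at the unit scale `K`. [folklore] -/
def TransportLaw (K : ℕ) (ω : ℝ) (e τ : ℕ → ℕ → ℝ) : Prop :=
  ∀ i n, i + n + 2 ≤ K → e i (n + 1) ≤ ω * e i n + τ i n

/-- HYPOTHESIS SHAPE `BirthChannels` (NOT PRINTED; asserted nowhere): the Duhamel decomposition of the pair-`j` birth discrepancy of the two
runs' (2.13)-terms — explicit η-sources `σ j`, the coupling channel `ℓ′·|g^A_j − g^B_{j+1}|` (Cauchy estimate in g_k),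
and the MEMORY channel through the curly bracket of (2.12) with coefficient `μ` (skeleton leaf L-μ: of order g_k, since
the exponent of (2.13) vanishes at g_k = 0, p. 268 — NOT PRINTED as a bound) acting on the transported older pair
discrepancies `e i (j−1−i)`, `i < j`, and on run B's unpartnered finest bracket `u j`. [folklore] -/
def BirthChannels (K : ℕ) (ℓ' μ : ℝ) (gA gB : ℕ → ℝ) (b σ u : ℕ → ℝ) (e : ℕ → ℕ → ℝ) : Prop :=
  ∀ j, j < K → b j ≤ σ j + ℓ' * |gA j - gB (j + 1)| + μ * ((∑ i ∈ range j, e i (j - 1 - i)) + u j)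

/-- HYPOTHESIS SHAPE `BirthProjection` (NOT PRINTED; asserted nowhere): the discrepancy of the PROPAGATING pair-`i` bracket at age 0 (the merged term
minus its marginal part `β·A^η`, (0.23)) is at most `p₀ ×` the birth discrepancy of the (2.13)-terms plus the discrepancy
`z i` of the explicit one-loop part (normalized log-determinant of `C*Δ^{(k)}(U)C`, p. 268 — an NE2-kind source). [folklore] -/
def BirthProjection (K : ℕ) (p₀ : ℝ) (b z : ℕ → ℝ) (e : ℕ → ℕ → ℝ) : Prop :=
  ∀ i, i < K → e i 0 ≤ p₀ * b i + z i

/-! ## §2 Kernel bookkeeping: channels ⇒ `TwoRunRenewal` with a fading memory kernel -/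

/-- The finite two-variable geometric sum: `Σ_{i<j} ω^{j−1−i} ρ^i = (ρ^j − ω^j)/(ρ − ω) ≤ ρ^j/(ρ − ω)` for `0 ≤ ω < ρ`.
[folklore] -/
theorem sum_pow_mul_pow_le {ω ρ : ℝ} (hω : 0 ≤ ω) (hωρ : ω < ρ) (j : ℕ) :
    ∑ i ∈ range j, ω ^ (j - 1 - i) * ρ ^ i ≤ ρ ^ j / (ρ - ω) := by
  have hden : 0 < ρ - ω := sub_pos.mpr hωρ
  have key : (∑ i ∈ range j, ρ ^ i * ω ^ (j - 1 - i)) * (ρ - ω) = ρ ^ j - ω ^ j :=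
    Commute.geom_sum₂_mul (Commute.all ρ ω) j
  have e : ∑ i ∈ range j, ω ^ (j - 1 - i) * ρ ^ i = ∑ i ∈ range j, ρ ^ i * ω ^ (j - 1 - i) :=
    Finset.sum_congr rfl fun i _ => mul_comm _ _
  rw [e, le_div_iff₀ hden, key]
  linarith [pow_nonneg hω j]

/-- TRANSPORT UNROLLED: under `TransportLaw K ω e τ` with sources `τ i n ≤ aτ·ρ^i·ν^n`, `0 ≤ ν < ω`, the pair-`i`
discrepancy at age `n` (level `i + 1 + n ≤ K`) is at most `ω^n·e i 0 + aτ·ρ^i·ω^n/(ω − ν)`.  Induction on the age with the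
identity `(ω^{n+1} − ν^{n+1}) = ω(ω^n − ν^n) + ν^n(ω − ν)`. [folklore] -/
theorem transport_unrolled {K : ℕ} {ω ν aτ ρ : ℝ} {e τ : ℕ → ℕ → ℝ}
    (hω : 0 ≤ ω) (hν : 0 ≤ ν) (hνω : ν < ω) (haτ : 0 ≤ aτ) (hρ : 0 ≤ ρ)
    (htr : TransportLaw K ω e τ) (hτ : ∀ i n, τ i n ≤ aτ * ρ ^ i * ν ^ n) :
    ∀ i n, i + n + 1 ≤ K → e i n ≤ ω ^ n * e i 0 + aτ * ρ ^ i * (ω ^ n / (ω - ν)) := by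
  have hden : 0 < ω - ν := sub_pos.mpr hνω
  -- sharper closed form first
  have main : ∀ i n, i + n + 1 ≤ K →
      e i n ≤ ω ^ n * e i 0 + aτ * ρ ^ i * ((ω ^ n - ν ^ n) / (ω - ν)) := by
    intro i n
    induction n with
    | zero => intro _; simp
    | succ n ih =>
        intro hK
        have h1 := ih (by omega)
        have h2 := htr i n (by omega)
        have h3 := hτ i n
        have h4 : ω * e i n ≤ ω * (ω ^ n * e i 0 + aτ * ρ ^ i * ((ω ^ n - ν ^ n) / (ω - ν))) :=
          mul_le_mul_of_nonneg_left h1 hω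
        have e5 : ω * (ω ^ n * e i 0 + aτ * ρ ^ i * ((ω ^ n - ν ^ n) / (ω - ν))) + aτ * ρ ^ i * ν ^ n
            = ω ^ (n + 1) * e i 0 + aτ * ρ ^ i * ((ω ^ (n + 1) - ν ^ (n + 1)) / (ω - ν)) := by
          field_simp
          ring
        linarith
  intro i n hK
  have h := main i n hK
  have hle : (ω ^ n - ν ^ n) / (ω - ν) ≤ ω ^ n / (ω - ν) :=
    div_le_div_of_nonneg_right (by linarith [pow_nonneg hν n]) hden.le
  have := mul_le_mul_of_nonneg_left hle (mul_nonneg haτ (pow_nonneg hρ i))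
  linarith

/-- **THE LEAF CUT: ONE-STEP CHANNELS ⇒ THE TWO-RUN RENEWAL.**  Birth channels (`BirthChannels K ℓ′ μ`), birth-level
projection (`BirthProjection K p₀`), the transport law (`TransportLaw K ω`) with its geometric sources, and geometric
bounds on the explicit sources `σ ≤ a₁ρ^j`, `u ≤ aU·ρ^j`, `z ≤ aZ·ρ^i`, `τ i n ≤ aτ·ρ^i·ν^n` (`0 ≤ ν < ω < ρ`) give
`T4TwoRunMatching.TwoRunRenewal a ℓ′ ρ M gA gB b K` with the EXPLICIT memory kernel `M j i = μ·p₀·ω^{j−1−i}` and source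
constant `a = a₁ + μ·aU + μ·(aZ + aτ/(ω − ν))/(ρ − ω)`.  Pure bookkeeping; nothing of [Balaban1987RG1] is asserted.
[folklore] -/
theorem twoRunRenewal_of_channels {K : ℕ} {ℓ' μ p₀ ω ν ρ a₁ aU aZ aτ : ℝ} {gA gB b σ u z : ℕ → ℝ}
    {e τ : ℕ → ℕ → ℝ}
    (hμ : 0 ≤ μ) (hω : 0 ≤ ω) (hν : 0 ≤ ν) (hνω : ν < ω) (hωρ : ω < ρ)
    (haZ : 0 ≤ aZ) (haτ : 0 ≤ aτ)
    (hbirth : BirthChannels K ℓ' μ gA gB b σ u e) (hproj : BirthProjection K p₀ b z e)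
    (htr : TransportLaw K ω e τ)
    (hσ : ∀ j, σ j ≤ a₁ * ρ ^ j) (hu : ∀ j, u j ≤ aU * ρ ^ j) (hz : ∀ i, z i ≤ aZ * ρ ^ i)
    (hτ : ∀ i n, τ i n ≤ aτ * ρ ^ i * ν ^ n) :
    TwoRunRenewal (a₁ + μ * aU + μ * (aZ + aτ / (ω - ν)) / (ρ - ω)) ℓ' ρ
      (fun j i => μ * p₀ * ω ^ (j - 1 - i)) gA gB b K := by
  have hρ : 0 ≤ ρ := hω.trans hωρ.le
  have hden : 0 < ω - ν := sub_pos.mpr hνω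
  have hden' : 0 < ρ - ω := sub_pos.mpr hωρ
  intro j hj
  -- each transported older discrepancy
  have hei : ∀ i ∈ range j,
      e i (j - 1 - i) ≤ ω ^ (j - 1 - i) * (p₀ * b i) + (aZ + aτ / (ω - ν)) * (ω ^ (j - 1 - i) * ρ ^ i) := by
    intro i hi
    have hij : i < j := mem_range.mp hi
    have h1 := transport_unrolled hω hν hνω haτ hρ htr hτ i (j - 1 - i) (by omega)
    have h2 := hproj i (by omega)
    have h3 := hz i
    have hωn : 0 ≤ ω ^ (j - 1 - i) := pow_nonneg hω _
    have h4 : ω ^ (j - 1 - i) * e i 0 ≤ ω ^ (j - 1 - i) * (p₀ * b i + aZ * ρ ^ i) :=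
      mul_le_mul_of_nonneg_left (h2.trans (by linarith)) hωn
    have e5 : ω ^ (j - 1 - i) * (p₀ * b i + aZ * ρ ^ i) + aτ * ρ ^ i * (ω ^ (j - 1 - i) / (ω - ν))
        = ω ^ (j - 1 - i) * (p₀ * b i) + (aZ + aτ / (ω - ν)) * (ω ^ (j - 1 - i) * ρ ^ i) := by
      field_simp
      ring
    linarith
  have hsum : ∑ i ∈ range j, e i (j - 1 - i)
      ≤ ∑ i ∈ range j, (ω ^ (j - 1 - i) * (p₀ * b i) + (aZ + aτ / (ω - ν)) * (ω ^ (j - 1 - i) * ρ ^ i)) :=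
    Finset.sum_le_sum hei
  rw [Finset.sum_add_distrib, ← Finset.mul_sum] at hsum
  have hgeo := sum_pow_mul_pow_le hω hωρ j
  have hcoef : 0 ≤ aZ + aτ / (ω - ν) := add_nonneg haZ (div_nonneg haτ hden.le)
  have h6 : (aZ + aτ / (ω - ν)) * ∑ i ∈ range j, ω ^ (j - 1 - i) * ρ ^ i
      ≤ (aZ + aτ / (ω - ν)) * (ρ ^ j / (ρ - ω)) := mul_le_mul_of_nonneg_left hgeo hcoef
  have h7 := hbirth j hj
  have h8 := hσ j
  have h9 := hu j
  have h10 : μ * ((∑ i ∈ range j, e i (j - 1 - i)) + u j)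
      ≤ μ * ((∑ i ∈ range j, ω ^ (j - 1 - i) * (p₀ * b i)) + (aZ + aτ / (ω - ν)) * (ρ ^ j / (ρ - ω))
          + aU * ρ ^ j) :=
    mul_le_mul_of_nonneg_left (by linarith) hμ
  have e11 : ∑ i ∈ range j, μ * p₀ * ω ^ (j - 1 - i) * b i = μ * ∑ i ∈ range j, ω ^ (j - 1 - i) * (p₀ * b i) := by
    rw [Finset.mul_sum]
    exact Finset.sum_congr rfl fun i _ => by ring
  rw [e11]
  have e12 : (a₁ + μ * aU + μ * (aZ + aτ / (ω - ν)) / (ρ - ω)) * ρ ^ j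
      = a₁ * ρ ^ j + μ * ((aZ + aτ / (ω - ν)) * (ρ ^ j / (ρ - ω)) + aU * ρ ^ j) := by
    field_simp
    ring
  rw [e12]
  nlinarith [h7, h8, h9, h10]

/-- The channel memory kernel is a FADING MEMORY in the sense of node U2: `M j i = μ·p₀·ω^{j−1−i}` satisfies
`T4CouplingMatching.FadingMemory (μ·p₀/ω) ω M` for `0 < ω ≤ 1`. [folklore] -/
theorem fadingMemory_of_channels {μ p₀ ω : ℝ} (hμ : 0 ≤ μ) (hp₀ : 0 ≤ p₀) (hω0 : 0 < ω) (hω1 : ω ≤ 1) :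
    FadingMemory (μ * p₀ / ω) ω (fun j i => μ * p₀ * ω ^ (j - 1 - i)) := by
  intro k i hik
  dsimp only
  refine ⟨by positivity, ?_⟩
  have hne : ω ≠ 0 := hω0.ne'
  rcases Nat.eq_or_lt_of_le hik with h | h
  · subst h
    have h0 : i - 1 - i = 0 := by omega
    rw [h0, Nat.sub_self]
    simp only [pow_zero, mul_one]
    rw [le_div_iff₀ hω0]
    nlinarith [mul_nonneg hμ hp₀]
  · have hk : k - i = (k - 1 - i) + 1 := by omega
    have e : μ * p₀ / ω * ω ^ (k - i) = μ * p₀ * ω ^ (k - 1 - i) := by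
      rw [hk, pow_succ]
      field_simp
    rw [e]

/-- THE GAP IN THE CHANNEL CONSTANTS: node U2's strict memory gap `(1 + C)·ω < ρ` with `C = μ·p₀/ω` reads `ω + μ·p₀ < ρ` —
age contraction plus a memory coefficient that carries the coupling; satisfiable by taking γ small after L. [folklore] -/
theorem gap_iff {μ p₀ ω ρ : ℝ} (hω0 : 0 < ω) : (1 + μ * p₀ / ω) * ω < ρ ↔ ω + μ * p₀ < ρ := by
  have e : (1 + μ * p₀ / ω) * ω = ω + μ * p₀ := by field_simp
  rw [e]

/-! ## §3 Node U2's spine output from the channels, BY TYPE -/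

/-- **NODE U2's SPINE OUTPUT FROM THE ONE-STEP CHANNELS, K-UNIFORM (skeleton assembly).**  For the family of infrared-pinned
runs `g K` of (0.20) in the box ]0, γ] (node U1/H3 — binders), the one-step channels of §1 for every consecutive pair of runs
with constants FREE OF K, the read-out estimate `TwoRunReadOut S r` (binder; [Balaban1987RG1] (1.20)–(1.22): β¹ is a fixed
second-moment functional of the new (2.13)-term composed with the run's minimizer — the SAME functional for both runs),
(AF-0r) (binder `hconv`, β sub-cell), the gap `ω + μ·p₀ < ρ < 1` and the γ-window of `T4TwoRunMatching.disc_le_of_twoRun`: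
THEN `T4CauchySum.InjectedRate D 0 ρ (fun K j ↦ disc (g K) (g (K+1)) j)` — LITERALLY the binder `hinj` of the spine's
`T4TowerRateDischarge.uRateUpTo_of_nodes` (with `Cd := D`, `θc := ρ`).  `T4TwoRunMatching.injectedRate_of_twoRun_runs` ∘ §2.
Bookkeeping over UNPRINTED inputs; NOT summit progress. [folklore] -/
theorem injectedRate_of_channels {β : HBeta} (S : B12Beta.OneLoopSplit β) (g : ℕ → ℕ → ℝ) (gIR : ℝ)
    {b σ u z : ℕ → ℕ → ℝ} {e τ : ℕ → ℕ → ℕ → ℝ}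
    {γ binf c₀ r ℓ' μ p₀ ω ν ρ a₁ aU aZ aτ : ℝ}
    (hρ1 : ρ < 1) (hω0 : 0 < ω) (hω1 : ω ≤ 1) (hν : 0 ≤ ν) (hνω : ν < ω) (hgap : ω + μ * p₀ < ρ)
    (hc₀ : 0 ≤ c₀) (hr : 0 ≤ r) (hℓ' : 0 ≤ ℓ') (hμ : 0 ≤ μ) (hp₀ : 0 ≤ p₀)
    (ha₁ : 0 ≤ a₁) (haU : 0 ≤ aU) (haZ : 0 ≤ aZ) (haτ : 0 ≤ aτ)
    (hrun : ∀ K, RGEqH K β (g K)) (hbox : ∀ K i, i ≤ K → 0 < g K i ∧ g K i ≤ γ) (hpin : ∀ K, g K K = gIR)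
    (hconv : ∀ k, |S.β0 k - binf| ≤ c₀ * ρ ^ k)
    (hread : ∀ K, TwoRunReadOut S r (g K) (g (K + 1)) (b K) K)
    (hb0 : ∀ K i, i < K → 0 ≤ b K i)
    (hbirth : ∀ K, BirthChannels K ℓ' μ (g K) (g (K + 1)) (b K) (σ K) (u K) (e K))
    (hproj : ∀ K, BirthProjection K p₀ (b K) (z K) (e K))
    (htr : ∀ K, TransportLaw K ω (e K) (τ K))
    (hσ : ∀ K j, σ K j ≤ a₁ * ρ ^ j) (hu : ∀ K j, u K j ≤ aU * ρ ^ j) (hz : ∀ K i, z K i ≤ aZ * ρ ^ i)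
    (hτ : ∀ K i n, τ K i n ≤ aτ * ρ ^ i * ν ^ n)
    (hgain : r * (ℓ' * γ ^ 3) * ((ρ - ω) / (ρ - (1 + μ * p₀ / ω) * ω)) ≤ (1 - ρ) / 2) :
    T4CauchySum.InjectedRate
      (2 * (2 * c₀ + r * (a₁ + μ * aU + μ * (aZ + aτ / (ω - ν)) / (ρ - ω))
        * ((ρ - ω) / (ρ - (1 + μ * p₀ / ω) * ω))) / (1 - ρ)) 0 ρ
      (fun K j => disc (g K) (g (K + 1)) j) := by
  have hωρ : ω < ρ := by nlinarith [mul_nonneg hμ hp₀]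
  have hsmall : (1 + μ * p₀ / ω) * ω < ρ := (gap_iff hω0).mpr hgap
  have hC : 0 ≤ μ * p₀ / ω := by positivity
  have ha : 0 ≤ a₁ + μ * aU + μ * (aZ + aτ / (ω - ν)) / (ρ - ω) := by
    have h1 : 0 ≤ aτ / (ω - ν) := div_nonneg haτ (sub_pos.mpr hνω).le
    have h2 : 0 ≤ μ * (aZ + aτ / (ω - ν)) / (ρ - ω) :=
      div_nonneg (mul_nonneg hμ (add_nonneg haZ h1)) (sub_pos.mpr hωρ).le
    positivity
  exact T4TwoRunMatching.injectedRate_of_twoRun_runs S g gIR hρ1 hω0.le hC hsmall hc₀ ha hℓ' hr hrun hbox hpin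
    hconv hread
    (fun K => twoRunRenewal_of_channels hμ hω0.le hν hνω hωρ haZ haτ (hbirth K) (hproj K) (htr K)
      (hσ K) (hu K) (hz K) (hτ K))
    hb0 (fun _ => fadingMemory_of_channels hμ hp₀ hω0 hω1) hgain

end Summit.QuantumFields.BalabanUV.T4Continuum.NE4TwoRunChannels
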